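import Mathlib
import HarnessLib
import Literature.Analysis.FluidPDE.NewtonPotentialHolder
import Literature.Analysis.FluidPDE.SelfSimilar
import Literature.Analysis.FluidPDE.LocalTypeI
import Literature.Analysis.FluidPDE.TypeIAncientMild
import Summits.NavierStokesRegularity.NavierStokesRegularity.Theorems.ChiralWindowDoorDefs

/-!
# Door S20 «ChiralWindowDoor» — the scale-invariant ENERGY LEDGER of a decaying profile (tools for stub B5b)

Door S20 of nsreg-p1's local Type-I door family (`HOME/ns-regularity-ideate-p1/r19/ROUND-19-DRAFT.md`, line
`r19/Sketch20v5.lean` 7f13084196f4f031; DESIGN-ONLY, route NOT born).  Stub B5b of its residue line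
(`stub_essLocalClass`: a door-class profile with slices bounded in `L³(B₁)` is not backward-singular) is bookkeeping
onto the tree's unit-scale ESS contrapositive `…Theorems.localL3BlowupSingular_unit`, whose hypothesis `h5` is the
Albritton–Barker energy ledger `A, E ≤ C` on all backward parabolic balls.  This file derives that ledger FROM DECAY
(so far the tree only ever derived it for blow-up limits, via CKN):

* `setIntegral_ball_inv_norm_add_sq_le`, `integral_inv_norm_add_pow_four_le`, `integral_Ioo_rpow_neg_half_le` — the
  three radial / one-dimensional integrals: `∫_{B_r(x₀)} (‖x‖+a)⁻² ≤ 9|B₁| r` for EVERY centre `x₀` (no rearrangement: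
  near centres sit in `B_{3r}(0)`, far centres see `‖x‖ > r`), `∫_{ℝ³} (‖x‖+a)⁻⁴ ≤ 4|B₁|/a`, and
  `∫_{t₀−r²}^{t₀} (−t)^{−1/2} dt ≤ 2r` for `t₀ ≤ 0` (tree `NewtonPotentialHolder.integral_ball_norm_rpow_neg` /
  `integral_compl_ball_norm_rpow_neg`, Mathlib `integral_rpow`; the far field of `‖x‖⁻⁴` is the substrate's
  `integrable_lamKTrunc`);
* `energyLedger_of_decay` — **a profile with Type-I space–time decay `‖v‖ ≤ D/(‖x‖+√(−t))` and the gradient decay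
  `(‖x‖+√(−t))²‖∇v‖ ≤ K` (first conjunct of R19's binder `HasTypeIDerivDecay`) carries the ledger on EVERY backward
  parabolic ball `Q_r(t₀,x₀)`, `t₀ ≤ 0`: `r⁻¹∫_{B_r(x₀)}‖v(t)‖² ≤ 9|B₁|D² + 8|B₁|K²` for each `t`, and
  `r⁻¹∬_{Q_r}‖∇v‖² ≤ 9|B₁|D² + 8|B₁|K²`** — exactly the `h5` shape of `classPressure_holds` /
  `localL3BlowupSingular_unit` / the ClockCeiling and SqueezeCycle bookkeeping;
* `exists_large_of_isBackwardSingularPoint` — glue (a backward-singular apex is pointwise unbounded on every backward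
  cylinder; the monotonicity of the class constant `IsTypeIAncientMild C ⊆ IsTypeIAncientMild C'`, `C ≤ C'`, is the
  tree's `…TargetNegative.HeadInfluxLawCostume.isTypeIAncientMild_of_le` and is inlined where used).

Seat nsreg-p6 g11 (THEOREMS-ONLY door sequels, DIRECTOR-NS g8 #32 (2)/#36).  WHAT THIS IS NOT: not NS regularity
(Clay A); not a statement about S20's cruxes — measure-theoretic plumbing for stub B5b
(`…Theorems.ChiralWindowDoorEssLocalClass`); no route is opened.
-/

noncomputable section

-- the summit and its single sub-problem share the name (CONVENTIONS §1), as in every Theorems file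
set_option linter.dupNamespace false

namespace Summit.NavierStokesRegularity.NavierStokesRegularity.Theorems.ChiralWindowDoorEnergyLedger

open MeasureTheory Set Function Filter Topology Metric
open scoped NNReal ENNReal
open Literature.Analysis Literature.Analysis.FluidPDE
open Summit.NavierStokesRegularity.NavierStokesRegularity.Theorems.ChiralWindowDoorDefs

/-! ### Three elementary integrals -/

/-- `x ↦ ((‖x‖ + a)²)⁻¹` is continuous for `a > 0`. -/
theorem continuous_inv_norm_add_sq {a : ℝ} (ha : 0 < a) :
    Continuous fun x : EuclideanSpace ℝ (Fin 3) => ((‖x‖ + a) ^ 2)⁻¹ :=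
  Continuous.inv₀ (by fun_prop) fun x => by positivity

/-- `x ↦ ((‖x‖ + a)⁴)⁻¹` is continuous for `a > 0`. -/
theorem continuous_inv_norm_add_pow_four {a : ℝ} (ha : 0 < a) :
    Continuous fun x : EuclideanSpace ℝ (Fin 3) => ((‖x‖ + a) ^ 4)⁻¹ :=
  Continuous.inv₀ (by fun_prop) fun x => by positivity

/-- The volume of a ball of `ℝ³`: `|B_r(x₀)| = r³ |B₁|`. -/
theorem volume_real_ball_fin3 (x₀ : EuclideanSpace ℝ (Fin 3)) {r : ℝ} (hr : 0 < r) :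
    (volume : Measure (EuclideanSpace ℝ (Fin 3))).real (ball x₀ r) =
      r ^ 3 * (volume : Measure (EuclideanSpace ℝ (Fin 3))).real (ball 0 1) := by
  rw [measureReal_def, measureReal_def, Measure.addHaar_ball_of_pos _ _ hr, finrank_euclideanSpace_fin,
    ENNReal.toReal_mul, ENNReal.toReal_ofReal (by positivity)]

/-- **`∫_{B_r(x₀)} (‖x‖+a)⁻² dx ≤ 9|B₁| r` for every centre `x₀`, every `a > 0`, `r > 0`.**  Near centres
(`‖x₀‖ ≤ 2r`): `B_r(x₀) ⊆ B_{3r}(0)` and `∫_{B_{3r}(0)}‖x‖⁻² = 9|B₁|r`; far centres: `‖x‖ > r` on the ball, so the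
integrand is `≤ r⁻²` on a set of volume `|B₁|r³`. -/
theorem setIntegral_ball_inv_norm_add_sq_le {a : ℝ} (ha : 0 < a) (x₀ : EuclideanSpace ℝ (Fin 3)) {r : ℝ}
    (hr : 0 < r) :
    ∫ x in ball x₀ r, ((‖x‖ + a) ^ 2)⁻¹ ≤
      9 * (volume : Measure (EuclideanSpace ℝ (Fin 3))).real (ball 0 1) * r := by
  set B : ℝ := (volume : Measure (EuclideanSpace ℝ (Fin 3))).real (ball 0 1) with hB
  have hB0 : 0 ≤ B := measureReal_nonneg
  have hnn : ∀ x : EuclideanSpace ℝ (Fin 3), 0 ≤ ((‖x‖ + a) ^ 2)⁻¹ := fun x => by positivity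
  by_cases hx₀ : ‖x₀‖ ≤ 2 * r
  · -- near centre
    have hsub : ball x₀ r ⊆ ball (0 : EuclideanSpace ℝ (Fin 3)) (3 * r) := by
      intro x hx
      rw [mem_ball_zero_iff]
      have h1 : ‖x - x₀‖ < r := by rwa [mem_ball, dist_eq_norm] at hx
      calc ‖x‖ = ‖(x - x₀) + x₀‖ := by rw [sub_add_cancel]
        _ ≤ ‖x - x₀‖ + ‖x₀‖ := norm_add_le _ _
        _ < r + 2 * r := by linarith
        _ = 3 * r := by ring
    have hint : IntegrableOn (fun x : EuclideanSpace ℝ (Fin 3) => ‖x‖ ^ (-(2 : ℝ))) (ball 0 (3 * r)) volume :=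
      integrableOn_ball_of_norm_le_rpow (by rw [finrank_euclideanSpace_fin]; norm_num)
        (C := 1) (α := 2) (by rw [finrank_euclideanSpace_fin]; norm_num)
        (Eventually.of_forall fun z => by
          rw [Real.norm_of_nonneg (Real.rpow_nonneg (norm_nonneg _) _), one_mul])
        (continuous_norm.measurable.pow_const _).aestronglyMeasurable
    have h0 : ∀ᵐ x ∂(volume : Measure (EuclideanSpace ℝ (Fin 3))), x ≠ 0 := by
      rw [ae_iff]; simp
    have hpt : ∀ᵐ x ∂(volume.restrict (ball x₀ r)), ((‖x‖ + a) ^ 2)⁻¹ ≤ ‖x‖ ^ (-(2 : ℝ)) := by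
      refine ae_restrict_of_ae ?_
      filter_upwards [h0] with x hx
      have hxpos : 0 < ‖x‖ := norm_pos_iff.2 hx
      rw [Real.rpow_neg hxpos.le, show (2 : ℝ) = ((2 : ℕ) : ℝ) by norm_num, Real.rpow_natCast]
      exact inv_anti₀ (by positivity) (pow_le_pow_left₀ hxpos.le (by linarith) 2)
    calc ∫ x in ball x₀ r, ((‖x‖ + a) ^ 2)⁻¹
        ≤ ∫ x in ball x₀ r, ‖x‖ ^ (-(2 : ℝ)) :=
          integral_mono_of_nonneg (Eventually.of_forall hnn) (hint.mono_set hsub) hpt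
      _ ≤ ∫ x in ball (0 : EuclideanSpace ℝ (Fin 3)) (3 * r), ‖x‖ ^ (-(2 : ℝ)) :=
          setIntegral_mono_set hint
            (Eventually.of_forall fun x => Real.rpow_nonneg (norm_nonneg _) _)
            (Eventually.of_forall hsub)
      _ = 3 * B * ((3 * r) ^ (3 - (2 : ℝ)) / (3 - 2)) :=
          NewtonPotentialHolder.integral_ball_norm_rpow_neg (by norm_num) (by positivity)
      _ = 9 * B * r := by
          rw [show (3 : ℝ) - 2 = 1 by norm_num, Real.rpow_one]
          ring
  · -- far centre: `‖x‖ > r` on the ball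
    push Not at hx₀
    have hpt : ∀ x ∈ ball x₀ r, ((‖x‖ + a) ^ 2)⁻¹ ≤ (r ^ 2)⁻¹ := by
      intro x hx
      have h1 : ‖x - x₀‖ < r := by rwa [mem_ball, dist_eq_norm] at hx
      have h2 : r ≤ ‖x‖ := by
        have : ‖x₀‖ ≤ ‖x‖ + ‖x - x₀‖ := by
          calc ‖x₀‖ = ‖x - (x - x₀)‖ := by rw [sub_sub_cancel]
            _ ≤ ‖x‖ + ‖x - x₀‖ := norm_sub_le _ _
        linarith
      exact inv_anti₀ (by positivity) (pow_le_pow_left₀ hr.le (by linarith) 2)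
    have hfin : volume (ball x₀ r) < ∞ := measure_ball_lt_top
    calc ∫ x in ball x₀ r, ((‖x‖ + a) ^ 2)⁻¹
        ≤ ∫ x in ball x₀ r, (r ^ 2)⁻¹ :=
          integral_mono_of_nonneg (Eventually.of_forall hnn) (integrableOn_const hfin.ne)
            ((ae_restrict_iff' measurableSet_ball).2 (Eventually.of_forall hpt))
      _ = (volume : Measure (EuclideanSpace ℝ (Fin 3))).real (ball x₀ r) * (r ^ 2)⁻¹ := by
          rw [setIntegral_const, smul_eq_mul]
      _ = B * r := by
          rw [volume_real_ball_fin3 x₀ hr]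
          field_simp
          ring
      _ ≤ 9 * B * r := by nlinarith

/-- `x ↦ ((‖x‖ + a)⁴)⁻¹` is integrable on `ℝ³` for `a > 0` (domination by the Japanese bracket of exponent `4 > 3`). -/
theorem integrable_inv_norm_add_pow_four {a : ℝ} (ha : 0 < a) :
    Integrable (fun x : EuclideanSpace ℝ (Fin 3) => ((‖x‖ + a) ^ 4)⁻¹) := by
  set m : ℝ := min a 1 with hm_def
  have hm : 0 < m := lt_min ha one_pos
  have hdom : Integrable (fun x : EuclideanSpace ℝ (Fin 3) => (m ^ 4)⁻¹ * (1 + ‖x‖) ^ (-(4 : ℝ))) :=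
    (integrable_one_add_norm (E := EuclideanSpace ℝ (Fin 3)) (μ := volume) (r := 4)
      (by rw [finrank_euclideanSpace_fin]; norm_num)).const_mul _
  refine hdom.mono' (continuous_inv_norm_add_pow_four ha).aestronglyMeasurable
    (Eventually.of_forall fun x => ?_)
  rw [Real.norm_eq_abs, abs_of_nonneg (by positivity)]
  have hkey : m * (1 + ‖x‖) ≤ ‖x‖ + a := by
    rcases le_total a 1 with h | h
    · rw [hm_def, min_eq_left h]
      nlinarith [norm_nonneg x]
    · rw [hm_def, min_eq_right h]
      linarith
  have h4 : (m * (1 + ‖x‖)) ^ 4 ≤ (‖x‖ + a) ^ 4 := pow_le_pow_left₀ (by positivity) hkey 4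
  rw [Real.rpow_neg (by positivity), show (4 : ℝ) = ((4 : ℕ) : ℝ) by norm_num, Real.rpow_natCast,
    ← mul_inv, ← mul_pow]
  exact inv_anti₀ (by positivity) h4

/-- **`∫_{ℝ³} (‖x‖+a)⁻⁴ dx ≤ 4|B₁|/a`** (`a > 0`): `≤ a⁻⁴` on `B_a(0)` (volume `|B₁|a³`) and `≤ ‖x‖⁻⁴` off it
(`∫_{‖x‖≥a}‖x‖⁻⁴ = 3|B₁|/a`).  (The exact value is `4π/(3a) = |B₁|/a`; the constant is immaterial.) -/
theorem integral_inv_norm_add_pow_four_le {a : ℝ} (ha : 0 < a) :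
    ∫ x : EuclideanSpace ℝ (Fin 3), ((‖x‖ + a) ^ 4)⁻¹ ≤
      4 * (volume : Measure (EuclideanSpace ℝ (Fin 3))).real (ball 0 1) / a := by
  set B : ℝ := (volume : Measure (EuclideanSpace ℝ (Fin 3))).real (ball 0 1) with hB
  have hint := integrable_inv_norm_add_pow_four ha
  have hnn : ∀ x : EuclideanSpace ℝ (Fin 3), 0 ≤ ((‖x‖ + a) ^ 4)⁻¹ := fun x => by positivity
  rw [← integral_add_compl (measurableSet_ball (x := (0 : EuclideanSpace ℝ (Fin 3))) (ε := a)) hint]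
  -- near field
  have hnear : ∫ x in ball (0 : EuclideanSpace ℝ (Fin 3)) a, ((‖x‖ + a) ^ 4)⁻¹ ≤ B / a := by
    have hfin : volume (ball (0 : EuclideanSpace ℝ (Fin 3)) a) < ∞ := measure_ball_lt_top
    calc ∫ x in ball (0 : EuclideanSpace ℝ (Fin 3)) a, ((‖x‖ + a) ^ 4)⁻¹
        ≤ ∫ x in ball (0 : EuclideanSpace ℝ (Fin 3)) a, (a ^ 4)⁻¹ := by
          refine integral_mono_of_nonneg (Eventually.of_forall hnn) (integrableOn_const hfin.ne)
            (Eventually.of_forall fun x => ?_)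
          exact inv_anti₀ (by positivity) (pow_le_pow_left₀ ha.le (by linarith [norm_nonneg x]) 4)
      _ = (volume : Measure (EuclideanSpace ℝ (Fin 3))).real (ball 0 a) * (a ^ 4)⁻¹ := by
          rw [setIntegral_const, smul_eq_mul]
      _ = B / a := by
          rw [volume_real_ball_fin3 0 ha]
          field_simp
          ring
  -- far field
  have hfar : ∫ x in (ball (0 : EuclideanSpace ℝ (Fin 3)) a)ᶜ, ((‖x‖ + a) ^ 4)⁻¹ ≤ 3 * B / a := by
    have hint4 : IntegrableOn (fun x : EuclideanSpace ℝ (Fin 3) => ‖x‖ ^ (-(4 : ℝ))) (ball 0 a)ᶜ volume := by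
      have h := ((integrable_lamKTrunc (half_pos ha)).const_mul (Real.pi ^ 2)).integrableOn
        (s := (ball (0 : EuclideanSpace ℝ (Fin 3)) a)ᶜ)
      refine h.congr_fun (fun x hx => ?_) measurableSet_ball.compl
      have hxa : a ≤ ‖x‖ := by simpa [mem_ball_zero_iff] using hx
      have hx0 : 0 < ‖x‖ := ha.trans_le hxa
      show Real.pi ^ 2 * lamKTrunc (a / 2) x = ‖x‖ ^ (-(4 : ℝ))
      rw [lamKTrunc_of_lt (by linarith), lamK, Real.rpow_neg hx0.le,
        show (4 : ℝ) = ((4 : ℕ) : ℝ) by norm_num, Real.rpow_natCast]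
      have hπ : Real.pi ^ 2 ≠ 0 := by positivity
      field_simp
    calc ∫ x in (ball (0 : EuclideanSpace ℝ (Fin 3)) a)ᶜ, ((‖x‖ + a) ^ 4)⁻¹
        ≤ ∫ x in (ball (0 : EuclideanSpace ℝ (Fin 3)) a)ᶜ, ‖x‖ ^ (-(4 : ℝ)) := by
          refine setIntegral_mono_on hint.integrableOn hint4 measurableSet_ball.compl fun x hx => ?_
          have hxa : a ≤ ‖x‖ := by simpa [mem_ball_zero_iff] using hx
          have hx0 : 0 < ‖x‖ := ha.trans_le hxa
          rw [Real.rpow_neg hx0.le, show (4 : ℝ) = ((4 : ℕ) : ℝ) by norm_num, Real.rpow_natCast]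
          exact inv_anti₀ (by positivity) (pow_le_pow_left₀ (norm_nonneg _) (by linarith) 4)
      _ = 3 * B * (a ^ (3 - (4 : ℝ)) / (4 - 3)) :=
          NewtonPotentialHolder.integral_compl_ball_norm_rpow_neg (by norm_num) ha
      _ = 3 * B / a := by
          rw [show (3 : ℝ) - 4 = -1 by norm_num, Real.rpow_neg_one]
          field_simp
          ring
  calc (∫ x in ball (0 : EuclideanSpace ℝ (Fin 3)) a, ((‖x‖ + a) ^ 4)⁻¹) +
        ∫ x in (ball (0 : EuclideanSpace ℝ (Fin 3)) a)ᶜ, ((‖x‖ + a) ^ 4)⁻¹ ≤ B / a + 3 * B / a :=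
        add_le_add hnear hfar
    _ = 4 * B / a := by ring

/-- **`∫_{t₀−r²}^{t₀} (−t)^{−1/2} dt ≤ 2r` for `t₀ ≤ 0`, `r > 0`** (the value is `2(√(r²−t₀) − √(−t₀))`), with
the integrability of the integrand on that interval. -/
theorem integral_Ioo_rpow_neg_half_le {t₀ r : ℝ} (ht₀ : t₀ ≤ 0) (hr : 0 < r) :
    IntegrableOn (fun t : ℝ => (-t) ^ (-(1 / 2 : ℝ))) (Ioo (t₀ - r ^ 2) t₀) volume ∧
      ∫ t in Ioo (t₀ - r ^ 2) t₀, (-t) ^ (-(1 / 2 : ℝ)) ≤ 2 * r := by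
  have hle : t₀ - r ^ 2 ≤ t₀ := by nlinarith
  have hii : IntervalIntegrable (fun t : ℝ => (-t) ^ (-(1 / 2 : ℝ))) volume (t₀ - r ^ 2) t₀ := by
    have h := (intervalIntegral.intervalIntegrable_rpow' (a := -t₀) (b := -(t₀ - r ^ 2))
      (by norm_num : (-1 : ℝ) < -(1 / 2 : ℝ))).comp_sub_left 0
    simp only [zero_sub, neg_neg] at h
    exact h.symm
  have hint : IntegrableOn (fun t : ℝ => (-t) ^ (-(1 / 2 : ℝ))) (Ioo (t₀ - r ^ 2) t₀) volume := by
    have h := hii.1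
    exact h.mono_set Ioo_subset_Ioc_self
  refine ⟨hint, ?_⟩
  have hval : ∫ t in Ioo (t₀ - r ^ 2) t₀, (-t) ^ (-(1 / 2 : ℝ)) =
      ((-(t₀ - r ^ 2)) ^ (-(1 / 2 : ℝ) + 1) - (-t₀) ^ (-(1 / 2 : ℝ) + 1)) / (-(1 / 2 : ℝ) + 1) := by
    rw [← integral_Ioc_eq_integral_Ioo, ← intervalIntegral.integral_of_le hle,
      intervalIntegral.integral_comp_neg (fun s : ℝ => s ^ (-(1 / 2 : ℝ))),
      integral_rpow (Or.inl (by norm_num : (-1 : ℝ) < -(1 / 2 : ℝ)))]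
  rw [hval, show (-(1 / 2 : ℝ) + 1) = 1 / 2 by norm_num, show -(t₀ - r ^ 2) = r ^ 2 + -t₀ by ring,
    ← Real.sqrt_eq_rpow, ← Real.sqrt_eq_rpow]
  have hb : 0 ≤ -t₀ := neg_nonneg.2 ht₀
  have hkey : Real.sqrt (r ^ 2 + -t₀) ≤ r + Real.sqrt (-t₀) := by
    rw [Real.sqrt_le_left (by positivity)]
    nlinarith [Real.sq_sqrt hb, Real.sqrt_nonneg (-t₀)]
  have : (Real.sqrt (r ^ 2 + -t₀) - Real.sqrt (-t₀)) / (1 / 2 : ℝ) =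
      2 * (Real.sqrt (r ^ 2 + -t₀) - Real.sqrt (-t₀)) := by ring
  rw [this]
  linarith

/-! ### The scale-invariant energy ledger of a decaying profile -/

/-- **The energy ledger from Type-I space–time decay.**  If `‖v(t,x)‖ ≤ D/(‖x‖+√(−t))` (`HasTypeIDecay D v`) and
`(‖x‖+√(−t))² ‖∇v(t,x)‖ ≤ K` on `t < 0`, then on EVERY backward parabolic ball `Q_r(t₀,x₀) = (t₀−r², t₀) × B_r(x₀)`
with `t₀ ≤ 0`: `r⁻¹ ∫_{B_r(x₀)} ‖v(t)‖² ≤ 9|B₁|D² + 8|B₁|K²` for every `t ∈ (t₀−r², t₀)` and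
`r⁻¹ ∫_{t₀−r²}^{t₀}∫_{B_r(x₀)} ‖∇v‖² ≤ 9|B₁|D² + 8|B₁|K²` — the Albritton–Barker ledger `A, E ≤ C` in the shape
consumed by the tree's `classPressure_holds` / `localL3BlowupSingular_unit`.  No measurability of `v` is needed
(`integral_mono_of_nonneg`). -/
theorem energyLedger_of_decay {D K : ℝ} {v : ℝ → EuclideanSpace ℝ (Fin 3) → EuclideanSpace ℝ (Fin 3)}
    (hdecay : HasTypeIDecay D v)
    (hgrad : ∀ t < (0 : ℝ), ∀ x : EuclideanSpace ℝ (Fin 3),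
      (‖x‖ + Real.sqrt (-t)) ^ 2 * ‖fderiv ℝ (v t) x‖ ≤ K) :
    ∀ (x₀ : EuclideanSpace ℝ (Fin 3)) (t₀ r : ℝ), t₀ ≤ 0 → 0 < r →
      (∀ t, t₀ - r ^ 2 < t → t < t₀ → r⁻¹ * ∫ x in Metric.ball x₀ r, ‖v t x‖ ^ 2 ≤
          9 * (volume : Measure (EuclideanSpace ℝ (Fin 3))).real (ball 0 1) * D ^ 2 +
            8 * (volume : Measure (EuclideanSpace ℝ (Fin 3))).real (ball 0 1) * K ^ 2) ∧
        r⁻¹ * ∫ t in Set.Ioo (t₀ - r ^ 2) t₀, ∫ x in Metric.ball x₀ r, ‖fderiv ℝ (v t) x‖ ^ 2 ≤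
          9 * (volume : Measure (EuclideanSpace ℝ (Fin 3))).real (ball 0 1) * D ^ 2 +
            8 * (volume : Measure (EuclideanSpace ℝ (Fin 3))).real (ball 0 1) * K ^ 2 := by
  intro x₀ t₀ r ht₀ hr
  set B : ℝ := (volume : Measure (EuclideanSpace ℝ (Fin 3))).real (ball 0 1) with hB
  have hB0 : 0 ≤ B := measureReal_nonneg
  refine ⟨fun t h1 h2 => ?_, ?_⟩
  · -- the `A` ledger on one slice
    have ht : t < 0 := lt_of_lt_of_le h2 ht₀
    set a : ℝ := Real.sqrt (-t) with ha_def
    have ha : 0 < a := Real.sqrt_pos.2 (neg_pos.2 ht)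
    have hpt : ∀ x, ‖v t x‖ ^ 2 ≤ D ^ 2 * ((‖x‖ + a) ^ 2)⁻¹ := fun x => by
      have h := hdecay t ht x
      have hxa : 0 < ‖x‖ + a := by positivity
      have hD : 0 ≤ D := by
        by_contra hD
        push Not at hD
        have : D / (‖x‖ + a) < 0 := div_neg_of_neg_of_pos hD hxa
        linarith [norm_nonneg (v t x)]
      calc ‖v t x‖ ^ 2 ≤ (D / (‖x‖ + a)) ^ 2 := pow_le_pow_left₀ (norm_nonneg _) h 2
        _ = D ^ 2 * ((‖x‖ + a) ^ 2)⁻¹ := by rw [div_pow, div_eq_mul_inv]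
    have hintw : IntegrableOn (fun x : EuclideanSpace ℝ (Fin 3) => ((‖x‖ + a) ^ 2)⁻¹) (ball x₀ r) volume := by
      refine Measure.integrableOn_of_bounded (M := (a ^ 2)⁻¹) measure_ball_lt_top.ne
        (continuous_inv_norm_add_sq ha).aestronglyMeasurable (Eventually.of_forall fun x => ?_)
      rw [Real.norm_eq_abs, abs_of_nonneg (by positivity)]
      exact inv_anti₀ (by positivity) (pow_le_pow_left₀ ha.le (by linarith [norm_nonneg x]) 2)
    have hI : ∫ x in ball x₀ r, ‖v t x‖ ^ 2 ≤ D ^ 2 * (9 * B * r) := by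
      calc ∫ x in ball x₀ r, ‖v t x‖ ^ 2 ≤ ∫ x in ball x₀ r, D ^ 2 * ((‖x‖ + a) ^ 2)⁻¹ :=
            integral_mono_of_nonneg (Eventually.of_forall fun x => by positivity) (hintw.const_mul _)
              (Eventually.of_forall hpt)
        _ = D ^ 2 * ∫ x in ball x₀ r, ((‖x‖ + a) ^ 2)⁻¹ := integral_const_mul _ _
        _ ≤ D ^ 2 * (9 * B * r) :=
            mul_le_mul_of_nonneg_left (setIntegral_ball_inv_norm_add_sq_le ha x₀ hr) (sq_nonneg D)
    calc r⁻¹ * ∫ x in ball x₀ r, ‖v t x‖ ^ 2 ≤ r⁻¹ * (D ^ 2 * (9 * B * r)) :=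
          mul_le_mul_of_nonneg_left hI (inv_nonneg.2 hr.le)
      _ = 9 * B * D ^ 2 := by rw [inv_mul_eq_div, div_eq_iff hr.ne']; ring
      _ ≤ 9 * B * D ^ 2 + 8 * B * K ^ 2 := le_add_of_nonneg_right (by positivity)
  · -- the `E` ledger
    have hslice : ∀ t, t₀ - r ^ 2 < t → t < t₀ →
        ∫ x in ball x₀ r, ‖fderiv ℝ (v t) x‖ ^ 2 ≤ K ^ 2 * (4 * B) * (-t) ^ (-(1 / 2 : ℝ)) := by
      intro t h1 h2
      have ht : t < 0 := lt_of_lt_of_le h2 ht₀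
      set a : ℝ := Real.sqrt (-t) with ha_def
      have ha : 0 < a := Real.sqrt_pos.2 (neg_pos.2 ht)
      have hpt : ∀ x, ‖fderiv ℝ (v t) x‖ ^ 2 ≤ K ^ 2 * ((‖x‖ + a) ^ 4)⁻¹ := fun x => by
        have h := hgrad t ht x
        have hxa : 0 < (‖x‖ + a) ^ 2 := by positivity
        have h' : ‖fderiv ℝ (v t) x‖ ≤ K / (‖x‖ + a) ^ 2 := by
          rw [le_div_iff₀ hxa, mul_comm]; exact h
        calc ‖fderiv ℝ (v t) x‖ ^ 2 ≤ (K / (‖x‖ + a) ^ 2) ^ 2 := pow_le_pow_left₀ (norm_nonneg _) h' 2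
          _ = K ^ 2 * ((‖x‖ + a) ^ 4)⁻¹ := by rw [div_pow, ← pow_mul, div_eq_mul_inv]
      have hint4 := integrable_inv_norm_add_pow_four ha
      calc ∫ x in ball x₀ r, ‖fderiv ℝ (v t) x‖ ^ 2
          ≤ ∫ x in ball x₀ r, K ^ 2 * ((‖x‖ + a) ^ 4)⁻¹ :=
            integral_mono_of_nonneg (Eventually.of_forall fun x => by positivity)
              (hint4.const_mul _).integrableOn (Eventually.of_forall hpt)
        _ ≤ ∫ x, K ^ 2 * ((‖x‖ + a) ^ 4)⁻¹ :=
            setIntegral_le_integral (hint4.const_mul _) (Eventually.of_forall fun x => by positivity)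
        _ = K ^ 2 * ∫ x, ((‖x‖ + a) ^ 4)⁻¹ := integral_const_mul _ _
        _ ≤ K ^ 2 * (4 * B / a) := mul_le_mul_of_nonneg_left (integral_inv_norm_add_pow_four_le ha) (sq_nonneg K)
        _ = K ^ 2 * (4 * B) * (-t) ^ (-(1 / 2 : ℝ)) := by
            rw [Real.rpow_neg (neg_pos.2 ht).le, ← Real.sqrt_eq_rpow, ← ha_def]
            field_simp
    obtain ⟨hint_t, hval⟩ := integral_Ioo_rpow_neg_half_le ht₀ hr
    have hE : ∫ t in Ioo (t₀ - r ^ 2) t₀, ∫ x in ball x₀ r, ‖fderiv ℝ (v t) x‖ ^ 2 ≤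
        K ^ 2 * (4 * B) * (2 * r) := by
      calc ∫ t in Ioo (t₀ - r ^ 2) t₀, ∫ x in ball x₀ r, ‖fderiv ℝ (v t) x‖ ^ 2
          ≤ ∫ t in Ioo (t₀ - r ^ 2) t₀, K ^ 2 * (4 * B) * (-t) ^ (-(1 / 2 : ℝ)) := by
            refine integral_mono_of_nonneg ?_ (hint_t.const_mul _) ?_
            · exact Eventually.of_forall fun t => integral_nonneg fun x => by positivity
            · exact (ae_restrict_iff' measurableSet_Ioo).2
                (Eventually.of_forall fun t ht => hslice t ht.1 ht.2)
        _ = K ^ 2 * (4 * B) * ∫ t in Ioo (t₀ - r ^ 2) t₀, (-t) ^ (-(1 / 2 : ℝ)) := integral_const_mul _ _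
        _ ≤ K ^ 2 * (4 * B) * (2 * r) := mul_le_mul_of_nonneg_left hval (by positivity)
    calc r⁻¹ * ∫ t in Ioo (t₀ - r ^ 2) t₀, ∫ x in ball x₀ r, ‖fderiv ℝ (v t) x‖ ^ 2
        ≤ r⁻¹ * (K ^ 2 * (4 * B) * (2 * r)) := mul_le_mul_of_nonneg_left hE (inv_nonneg.2 hr.le)
      _ = 8 * B * K ^ 2 := by rw [inv_mul_eq_div, div_eq_iff hr.ne']; ring
      _ ≤ 9 * B * D ^ 2 + 8 * B * K ^ 2 := le_add_of_nonneg_left (by positivity)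

/-! ### Glue: pointwise unboundedness at a singular apex -/

/-- A backward singular apex is POINTWISE unbounded on every backward cylinder `(−r², 0) × B_r(0)`. -/
theorem exists_large_of_isBackwardSingularPoint
    {v : ℝ → EuclideanSpace ℝ (Fin 3) → EuclideanSpace ℝ (Fin 3)} (hsing : IsBackwardSingularPoint v 0) :
    ∀ r > 0, ∀ M : ℝ, ∃ t ∈ Set.Ioo (-(r ^ 2)) (0 : ℝ),
      ∃ x ∈ Metric.ball (0 : EuclideanSpace ℝ (Fin 3)) r, M < ‖v t x‖ := by
  intro r hr M
  by_contra! hcon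
  have hmeas : MeasurableSet (parabolicCylinder r ((0 : ℝ), (0 : EuclideanSpace ℝ (Fin 3)))) :=
    (isOpen_parabolicCylinder _ _).measurableSet
  have hle : eLpNorm (uncurry v) ∞
      (volume.restrict (parabolicCylinder r ((0 : ℝ), (0 : EuclideanSpace ℝ (Fin 3))))) ≤ ENNReal.ofReal M := by
    rw [eLpNorm_exponent_top]
    refine eLpNormEssSup_le_of_ae_bound ((ae_restrict_iff' hmeas).2 (Eventually.of_forall ?_))
    intro z hz
    rw [mem_parabolicCylinder] at hz
    have ht : z.1 ∈ Set.Ioo (-(r ^ 2)) (0 : ℝ) := ⟨by linarith [hz.1.1], hz.1.2⟩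
    have hx : z.2 ∈ Metric.ball (0 : EuclideanSpace ℝ (Fin 3)) r := by
      rw [mem_ball]; exact hz.2
    exact hcon z.1 ht z.2 hx
  have h1 : eLpNorm (uncurry v) ∞
      (volume.restrict (parabolicCylinder r ((0 : ℝ), (0 : EuclideanSpace ℝ (Fin 3))))) = ∞ := hsing r hr
  rw [h1] at hle
  exact absurd hle (not_le.2 ENNReal.ofReal_lt_top)

end Summit.NavierStokesRegularity.NavierStokesRegularity.Theorems.ChiralWindowDoorEnergyLedger
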